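import Summits.QuantumFields.YangMills.Theorems.LuscherReductionDressedRitzPolyakovLiftTransplantDilation
import HarnessLib

/-!
# Route `LuscherReduction`, item `DressedRitz` (stmt-QuantumFields-20205), line «polyakovlift» r6 — the `L`-ADAPTED ROOT CHART and the registered basis
# predicate `TransplantBasisL` (F2/F5 of `R6-DESIGN.md`, root-chart variant; LEAD prover ym-lead-20205-polyakovlift g2)

Why a second chart.  In the angle-linear chart `expCoord` (tree `…PolyakovLiftTransplant.lean`) the Polyakov power map is the exact dilation
`expCoord μ (U^L) = expCoord (μ/L) U` (`…TransplantDilation.lean`), but the one-site quasimode technology of the tree (`qform_gnTrial_ge`,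
`le_l2_gnPullback`, …, LOWER lane of crux ONE) is written in the GNOMONIC chart `gnCoord μ`; an `L`-independent fine chart therefore costs an `O(1/L²)`
near-identity distortion `G ∘ ψ_μ` of every flat trial function, i.e. a change-of-variables calculus for `energyForm`.  The ROOT chart removes it: read the
fine observable through `rootCoord L μ` := "gnomonic coordinate of the `L`-th root, times `L`", the unique chart with
`rootCoord L μ (U^L) = gnCoord (μ/L) U` EXACTLY on the principal shell — so the one-site shadow of a transplanted observable IS the LOWER lane's pull-back
`G ∘ gnCoord (Λ/(2L))` of the SAME flat function `G = χ_R · f_{i+1}/f_0`, with no distortion at all.  The price — the fine observable depends on `L` through its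
chart, a relative `O(Λ²/L²)` deformation, invisible at every tolerance of the line — is paid in bookkeeping only (basis predicates `P L Λ g`,
tree `…PolyakovLiftBasisGenericL.lean`).

* `rootProfile L r = L·tan(arctan r / L)/r`, `rootRescale L μ`, `rootCoord L μ = rootRescale L μ ∘ gnCoord μ`; physical pull-backs (`isPhys_rootPullback`);
* `arctan_gnNorm_pow`, `gnNorm_pow`, `gnLink_pow` (de Moivre consequences of `expLink_pow`), ★ `rootCoord_powLink` (also for links near `−1`: the charts are
  blind to the centre, `IsNearCentre`);
* `transplantObsL L Λ R f i = transplantFn R f i ∘ rootCoord L (Λ/2)`, ★ the REGISTERED r6 predicate `TransplantBasisL k L Λ g` (AL1 family, `f_0 > 0`, radius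
  PINNED `1 ≤ R`, `1/8 ≤ RΛ ≤ 1/4` — cdisprove g5 pre-vet V1), `basisPhysL_transplantBasisL`, ★ `transplantObsL_powLink`.

HONEST FRAMING: chart algebra and definitions (conditional femto rung R2b1); nothing here bears on infinite volume, the continuum limit or the Clay gap.
References: Bröcker–tom Dieck I (1.10) [cite: BrockerTomDieck1985, I (1.10)]; M. Lüscher, NPB 219 (1983) 233 [cite: Luscher1983, §2–§3];
Reed–Simon IV [cite: ReedSimonIV1978, Thm. XIII.64].
-/

set_option autoImplicit false

noncomputable section

open MeasureTheory Filter Topology Real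
open Literature.MathematicalPhysics.QuantumFieldTheory (GaugeConfig Site gaugeTransform)
open Literature.Analysis.OperatorTheory.YMMatrixModel
open scoped BigOperators Matrix

namespace Summit.QuantumFields.YangMills.Theorems.FemtoTransferGap.PolyakovLift

open Summit.QuantumFields.YangMills.Theorems.FemtoTransferGap

/-! ## §1 Norms in the angle-linear chart -/

/-- `atanc r · r = arctan r`. [folklore] -/
theorem atanc_mul_self (r : ℝ) : atanc r * r = Real.arctan r := by
  unfold atanc
  split_ifs with h
  · rw [h, Real.arctan_zero, mul_zero]
  · rw [div_mul_cancel₀ _ h]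

/-- `gnNorm W ≥ 0`. [folklore] -/
theorem gnNorm_nonneg (W : SU2) : 0 ≤ gnNorm W := Real.sqrt_nonneg _

/-- `Σ_a (expLink W a)² = arctan(|gn W|)²`. [folklore] -/
theorem sum_sq_expLink (W : SU2) : ∑ a, expLink W a ^ 2 = Real.arctan (gnNorm W) ^ 2 := by
  have h : ∑ a, expLink W a ^ 2 = atanc (gnNorm W) ^ 2 * ∑ a, gnLink W a ^ 2 := by
    simp only [expLink, mul_pow, Finset.mul_sum]
  rw [h, ← atanc_mul_self, mul_pow, gnNorm, Real.sq_sqrt (Finset.sum_nonneg fun _ _ => sq_nonneg _)]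

/-! ## §2 The root chart -/

/-- The root profile `L·tan(arctan r / L)/r` (value `1` at `r = 0`; for `L = 0` junk). [folklore] -/
def rootProfile (L : ℕ) (r : ℝ) : ℝ := if r = 0 then 1 else (L : ℝ) * Real.tan (Real.arctan r / L) / r

/-- `rootProfile` is measurable. [folklore] -/
theorem measurable_rootProfile (L : ℕ) : Measurable (rootProfile L) := by
  refine Measurable.ite (measurableSet_singleton 0) measurable_const ?_
  have htan : Measurable Real.tan := fun t ht => by
    have : Real.tan = fun x => Real.sin x / Real.cos x := funext Real.tan_eq_sin_div_cos
    rw [this]; exact (Real.measurable_sin.div Real.measurable_cos) ht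
  exact ((htan.comp (Real.continuous_arctan.measurable.div_const _)).const_mul _).div measurable_id

/-- The per-link ROOT RESCALING at scale `μ`: `y_i ↦ rootProfile L (μ|y_i|) · y_i`. [folklore] -/
def rootRescale (L : ℕ) (μ : ℝ) (y : ZM) : ZM :=
  WithLp.toLp 2 fun p : Fin 3 × Fin 3 => rootProfile L (μ * Real.sqrt (linkNormSq y p.1)) * y p

/-- Coordinates of `rootRescale`. [folklore] -/
@[simp] theorem rootRescale_apply (L : ℕ) (μ : ℝ) (y : ZM) (p : Fin 3 × Fin 3) :
    rootRescale L μ y p = rootProfile L (μ * Real.sqrt (linkNormSq y p.1)) * y p := rfl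

/-- The `L`-ADAPTED ROOT CHART at scale `μ`: `rootCoord L μ = rootRescale L μ ∘ gnCoord μ` — link `±U_i = cos θ_i + sin θ_i n_i·σ` (`θ_i ∈ [0,π/2)`) is sent to
`L·tan(θ_i/L)·n_i/μ`, the gnomonic coordinate at scale `μ/L` of its principal `L`-th root. [cite: Luscher1983, §2] -/
def rootCoord (L : ℕ) (μ : ℝ) (U : Cfg) : ZM := rootRescale L μ (gnCoord μ U)

/-- `rootRescale` commutes with colour rotations. [folklore] -/
theorem rootRescale_colourRotate {M : Matrix (Fin 3) (Fin 3) ℝ} (hM : M ∈ Matrix.specialOrthogonalGroup (Fin 3) ℝ) (L : ℕ) (μ : ℝ) (y : ZM) :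
    rootRescale L μ (colourRotate M y) = colourRotate M (rootRescale L μ y) := by
  ext p
  rw [rootRescale_apply, linkNormSq_colourRotate hM, colourRotate_apply, colourRotate_apply, Finset.mul_sum]
  refine Finset.sum_congr rfl fun b _ => ?_
  rw [rootRescale_apply]
  ring

/-- `rootRescale` is measurable. [folklore] -/
theorem measurable_rootRescale (L : ℕ) (μ : ℝ) : Measurable (rootRescale L μ) := by
  refine (PiLp.continuous_toLp 2 _).measurable.comp (measurable_pi_lambda _ fun p => ?_)
  have hn : Measurable fun y : ZM => linkNormSq y p.1 := by
    unfold linkNormSq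
    exact Finset.measurable_sum _ fun a _ => ((PiLp.continuous_apply 2 _ (p.1, a)).measurable).pow_const 2
  exact ((measurable_rootProfile L).comp ((hn.sqrt).const_mul μ)).mul (PiLp.continuous_apply 2 _ p).measurable

/-- A colour-invariant function stays colour-invariant after the root rescaling. [folklore] -/
theorem isGaugeInv_comp_rootRescale {G : ZM → ℝ} (hG : IsGaugeInv G) (L : ℕ) (μ : ℝ) : IsGaugeInv (G ∘ rootRescale L μ) :=
  fun M hM y => by simp only [Function.comp_apply, rootRescale_colourRotate hM, hG M hM]

/-- **Physical pull-backs along the root chart**: for `G` measurable, bounded, colour-invariant, `G ∘ rootCoord L μ` is physical. [cite: Luscher1983, §2–§3] -/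
theorem isPhys_rootPullback {G : ZM → ℝ} (hGm : Measurable G) (hGb : ∃ C : ℝ, ∀ x, |G x| ≤ C) (hG : IsGaugeInv G) (L : ℕ) (μ : ℝ) :
    IsPhys (fun U : Cfg => G (rootCoord L μ U)) := by
  show IsPhys (fun U : Cfg => (G ∘ rootRescale L μ) (gnCoord μ U))
  refine isPhys_gnPullback (hGm.comp (measurable_rootRescale L μ)) ?_ (isGaugeInv_comp_rootRescale hG L μ) μ
  obtain ⟨C, hC⟩ := hGb
  exact ⟨C, fun y => hC _⟩

/-! ## §3 De Moivre consequences and the exact dilation -/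

/-- `arctan|gn(W^L)| = L · arctan|gn W|` for `L`-principal `W`. [cite: BrockerTomDieck1985, I (1.10)] -/
theorem arctan_gnNorm_pow {L : ℕ} {W : SU2} (h : IsPrincipal L W) :
    Real.arctan (gnNorm (W ^ L)) = (L : ℝ) * Real.arctan (gnNorm W) := by
  have h1 : ∑ a, expLink (W ^ L) a ^ 2 = (L : ℝ) ^ 2 * ∑ a, expLink W a ^ 2 := by
    simp only [expLink_pow h, Pi.smul_apply, smul_eq_mul, mul_pow, Finset.mul_sum]
  rw [sum_sq_expLink, sum_sq_expLink, ← mul_pow] at h1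
  have h0 : ∀ X : SU2, 0 ≤ Real.arctan (gnNorm X) := fun X => by
    have := Real.arctan_strictMono.monotone (gnNorm_nonneg X); rwa [Real.arctan_zero] at this
  exact (sq_eq_sq₀ (h0 _) (mul_nonneg (Nat.cast_nonneg L) (h0 W))).1 h1

/-- `|gn(W^L)| = tan(L · arctan|gn W|)` for `L`-principal `W`. [cite: BrockerTomDieck1985, I (1.10)] -/
theorem gnNorm_pow {L : ℕ} {W : SU2} (h : IsPrincipal L W) :
    gnNorm (W ^ L) = Real.tan ((L : ℝ) * Real.arctan (gnNorm W)) := by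
  rw [← arctan_gnNorm_pow h, Real.tan_arctan]

/-- `gn(W^L) = (|gn(W^L)| / (L·|gn W|)) · L · gn W`: precisely, `atanc|gn(W^L)| · gn(W^L) = L · atanc|gn W| · gn W`. [cite: BrockerTomDieck1985, I (1.10)] -/
theorem atanc_mul_gnLink_pow {L : ℕ} {W : SU2} (h : IsPrincipal L W) (a : Fin 3) :
    atanc (gnNorm (W ^ L)) * gnLink (W ^ L) a = (L : ℝ) * (atanc (gnNorm W) * gnLink W a) := by
  have := congrFun (expLink_pow h) a
  simpa [expLink, Pi.smul_apply, smul_eq_mul] using this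

/-- The root profile undoes the power on the principal branch: `rootProfile L (tan(Lθ))·(atanc·)… = …`; packaged as
`rootProfile L |gn(W^L)| · gn(W^L) = L · gn W` for `L`-principal `W`, `L ≥ 1`. [cite: BrockerTomDieck1985, I (1.10)] -/
theorem rootProfile_mul_gnLink_pow {L : ℕ} (hL : 0 < L) {W : SU2} (h : IsPrincipal L W) (a : Fin 3) :
    rootProfile L (gnNorm (W ^ L)) * gnLink (W ^ L) a = (L : ℝ) * gnLink W a := by
  have hLθ := h.2
  have hL' : (0 : ℝ) < L := Nat.cast_pos.mpr hL
  have key := atanc_mul_gnLink_pow h a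
  have hr : gnNorm (W ^ L) = Real.tan ((L : ℝ) * Real.arctan (gnNorm W)) := gnNorm_pow h
  rcases (gnNorm_nonneg W).eq_or_lt with hg | hgpos
  · -- `gn W = 0`
    have hga : gnLink W a = 0 := by
      have hsum : ∑ b, gnLink W b ^ 2 = 0 := by
        have := Real.sqrt_eq_zero'.1 hg.symm
        exact le_antisymm this (Finset.sum_nonneg fun _ _ => sq_nonneg _)
      exact pow_eq_zero_iff (n := 2) (by norm_num) |>.1
        ((Finset.sum_eq_zero_iff_of_nonneg (fun b _ => sq_nonneg (gnLink W b))).1 hsum a (Finset.mem_univ a))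
    have hLa : gnLink (W ^ L) a = 0 := by
      rw [hga, mul_zero, mul_zero] at key
      exact (mul_eq_zero.1 key).resolve_left (atanc_pos_le_one _).1.ne'
    rw [hLa, hga, mul_zero, mul_zero]
  · have hθ : 0 < Real.arctan (gnNorm W) := Real.arctan_pos.2 hgpos
    have hLθpos : 0 < (L : ℝ) * Real.arctan (gnNorm W) := mul_pos hL' hθ
    have hrpos : 0 < gnNorm (W ^ L) := by rw [hr]; exact Real.tan_pos_of_pos_of_lt_pi_div_two hLθpos hLθ
    have harcr : Real.arctan (gnNorm (W ^ L)) = (L : ℝ) * Real.arctan (gnNorm W) := arctan_gnNorm_pow h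
    have hprof : rootProfile L (gnNorm (W ^ L)) = (L : ℝ) * gnNorm W / gnNorm (W ^ L) := by
      rw [rootProfile, if_neg hrpos.ne', harcr, mul_div_cancel_left₀ _ hL'.ne', Real.tan_arctan]
    have hatr : atanc (gnNorm (W ^ L)) = (L : ℝ) * Real.arctan (gnNorm W) / gnNorm (W ^ L) := by
      rw [atanc, if_neg hrpos.ne', harcr]
    have hatg : atanc (gnNorm W) = Real.arctan (gnNorm W) / gnNorm W := by rw [atanc, if_neg hgpos.ne']
    rw [hatr, hatg] at key
    rw [hprof]
    -- key : (Lθ/r)·X = L·((θ/g)·Y); goal: (Lg/r)·X = L·Y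
    have hX : gnLink (W ^ L) a * gnNorm W = gnNorm (W ^ L) * gnLink W a := by
      field_simp at key
      linarith [key]
    field_simp
    linarith [hX]

/-- A link is `L`-NEAR-CENTRE: it or its centre flip is `L`-principal (the charts are blind to the centre). [folklore] -/
def IsNearCentre (L : ℕ) (W : SU2) : Prop := IsPrincipal L W ∨ IsPrincipal L (negOne * W)

/-- `gn((−1)^j · X) = gn X`. [folklore] -/
theorem gnLink_negOne_pow_mul (j : ℕ) (X : SU2) : gnLink (negOne ^ j * X) = gnLink X := by
  induction j generalizing X with
  | zero => rw [pow_zero, one_mul]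
  | succ j ih => rw [pow_succ, mul_assoc, ih (negOne * X), gnLink_negOne_mul]

/-- ★★ **The Polyakov power map is an exact dilation from the root chart to the gnomonic chart**: `rootCoord L μ (powLink L U) = gnCoord (μ/L) U` whenever every
link of `U` is `L`-near-centre (`L ≥ 1`). [cite: Luscher1983, §2] -/
theorem rootCoord_powLink {L : ℕ} (hL : 0 < L) {μ : ℝ} (hμ : 0 < μ) {U : Cfg} (hU : ∀ i : Fin 3, IsNearCentre L (U (edgeOf i))) :
    rootCoord L μ (powLink L U) = gnCoord (μ / L) U := by
  have hL' : (0 : ℝ) < L := Nat.cast_pos.mpr hL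
  -- per-link identity, for near-centre links
  have hlink : ∀ W : SU2, IsNearCentre L W → ∀ a, rootProfile L (gnNorm (W ^ L)) * gnLink (W ^ L) a = (L : ℝ) * gnLink W a := by
    intro W hW a
    rcases hW with hP | hP
    · exact rootProfile_mul_gnLink_pow hL hP a
    · have h := rootProfile_mul_gnLink_pow hL hP a
      have hc : Commute negOne W := negOne_mul_comm W
      rw [hc.mul_pow, gnLink_negOne_mul] at h
      have hgn : gnLink (negOne ^ L * W ^ L) = gnLink (W ^ L) := gnLink_negOne_pow_mul L _
      have hnm : gnNorm (negOne ^ L * W ^ L) = gnNorm (W ^ L) := by rw [gnNorm, gnNorm, hgn]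
      rwa [hnm, hgn] at h
  ext p
  rw [rootCoord, rootRescale_apply, linkNormSq_gnCoord, Real.sqrt_div' _ (sq_nonneg μ), Real.sqrt_sq hμ.le, mul_div_cancel₀ _ hμ.ne',
    gnCoord_apply, gnCoord_apply, powLink_apply, ← gnNorm, mul_div_assoc', hlink _ (hU p.1) p.2]
  field_simp

/-! ## §4 The registered r6 observables and basis predicate -/

variable {k : ℕ}

/-- The transplanted one-site observable read through the `L`-adapted root chart: `g_i = (χ_R · f_{i+1}/f_0) ∘ rootCoord L (Λ/2)`. [cite: Luscher1983, §2–§3] -/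
def transplantObsL (L : ℕ) (Λ R : ℝ) (f : Fin (k + 1) → ZM → ℝ) (i : Fin k) : Cfg → ℝ :=
  fun U => transplantFn R f i (rootCoord L (Λ / 2) U)

/-- ★ **The registered r6 basis predicate `TransplantBasisL k L Λ g`**: `g_i = transplantObsL L Λ R f i` for an AL1 eigenfamily `f_0, …, f_k` of Lüscher's matrix
Hamiltonian with POSITIVE ground state and a cut-off radius pinned to the chart scale, `1 ≤ R`, `1/8 ≤ R·Λ ≤ 1/4`. [cite: ReedSimonIV1978, Thm. XIII.64] [cite: Luscher1983, §2–§3] -/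
def TransplantBasisL (k : ℕ) (L : ℕ) (Λ : ℝ) (g : Fin k → (Cfg → ℝ)) : Prop :=
  ∃ (f : Fin (k + 1) → ZM → ℝ) (R : ℝ), IsEigenFamily k f ∧ (∀ x, 0 < f 0 x) ∧ 1 ≤ R ∧ 1 / 8 ≤ R * Λ ∧ R * Λ ≤ 1 / 4 ∧
    ∀ i : Fin k, g i = transplantObsL L Λ R f i

/-- ★ Every member of a root-transplant basis is a physical one-site function. [cite: Luscher1983, §2–§3] -/
theorem basisPhysL_transplantBasisL (k : ℕ) :
    ∀ (L : ℕ) (Λ : ℝ) (g : Fin k → (Cfg → ℝ)), TransplantBasisL k L Λ g → ∀ i, IsPhys (g i) := by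
  intro L Λ g hg i
  obtain ⟨f, R, hf, hpos, hR1, -, -, hgi⟩ := hg
  obtain ⟨hm, hb, hinv⟩ := transplantFn_props (lt_of_lt_of_le one_pos hR1) hf hpos i
  rw [hgi i]
  exact isPhys_rootPullback hm hb hinv L (Λ / 2)

/-- ★★ **The one-site shadow of a transplanted observable is the LOWER lane's gnomonic pull-back of the same flat function at the one-site scale**:
`transplantObsL L Λ R f i (powLink L U) = transplantFn R f i (gnCoord (Λ/(2L)) U)` for `U` with `L`-near-centre links. [cite: Luscher1983, §2–§3] -/
theorem transplantObsL_powLink {L : ℕ} (hL : 0 < L) {Λ : ℝ} (hΛ : 0 < Λ) (R : ℝ) (f : Fin (k + 1) → ZM → ℝ) (i : Fin k)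
    {U : Cfg} (hU : ∀ j : Fin 3, IsNearCentre L (U (edgeOf j))) :
    transplantObsL L Λ R f i (powLink L U) = transplantFn R f i (gnCoord (Λ / (2 * L)) U) := by
  rw [transplantObsL, rootCoord_powLink hL (half_pos hΛ) hU, div_div]

end Summit.QuantumFields.YangMills.Theorems.FemtoTransferGap.PolyakovLift

end
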